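import Mathlib
import HarnessLib
import Summits.RiemannHypothesis.RiemannHypothesis.Theses.WeilParity
import Literature.NumberTheory.LFunctions.WeilGroundEnergyParitySplit
import Literature.NumberTheory.LFunctions.WeilWindowSuzukiProofs
import Literature.NumberTheory.LFunctions.WeilDilationVirial
import Summits.RiemannHypothesis.RiemannHypothesis.Theorems.WeilGroundStateArchimedeanWindowSimpleEven

/-!
# Line `birth` — BC3 skeleton for the crux `EvenWinsArch` (stmt-RiemannHypothesis-15433)

Route `WeilParity` (route-RiemannHypothesis-WeilParity), crux (rank 4, RH-free, difficulty L)
`EvenWinsArch`: for every prime-free window `0 < a ≤ (log 2)/2` every odd `L²`-normalised Weil test `o`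
on `[-a, a]` is matched, up to any `δ > 0`, by an even normalised one: `Re Q(e) ≤ Re Q(o) + δ`
(`Q = weilQuadratic`). In the tree's ground-energy language (`WeilGroundEnergyParitySplit.lean`,
`WeilOddGroundState.lean`) this is the ORDER of the two sector bottoms, `ε_ev(a) ≤ ε_od(a)`
(`ε_ev = weilEvenGroundEnergy`, `ε_od = weilOddGroundEnergy`; the equivalence with the matching form is
`evenWinsAt_of_le` below, sorry-free).

## THE LINE = MONOTONE BRACKETING ("parity ladder")

Both sector bottoms are non-increasing in the window (Bombieri 2000 Thm 5; tree:
`weilEvenGroundEnergy_antitone`, `weilOddGroundEnergy_antitone`). Hence ONE two-window parity certificate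
`ε_ev(w) ≤ ε_od(w')` with `w < w'` settles the order on the WHOLE cell `[w, w']`:
`ε_ev(a) ≤ ε_ev(w) ≤ ε_od(w') ≤ ε_od(a)` for `w ≤ a ≤ w'` (`le_of_bracket`, sorry-free) — no Lipschitz modulus,
no continuity of the bottoms is needed. So `EvenWinsArch` follows from
* the tree's Suzuki small-window gap on `(0, 1/100]` (`weilGroundEnergy_add_le_of_integral_eq_zero`:
  `ε(a) + 1/10 ≤ Re Q(odd normalised)`, whence `ε_ev(a) = ε(a) ≤ ε_od(a) − 1/10`; `le_of_small`, sorry-free), and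
* SEVEN rung certificates on the ladder `1/100 < 3/200 < 1/40 < 1/20 < 1/10 < 1/5 < 3/10 < (log 2)/2`,
  grouped by regime into the three registered stubs below.

Numerics behind the rungs (planner's pure-python Legendre Rayleigh–Ritz of the prime-free form via the
tree's Markov decomposition `Re Q = P + 𝓔_a − M_a‖g‖²`, `numerics/sectors.py` in the seat folder, N = 14 per
sector, agreeing to 4 digits with the refuters' 90-dps table in `Cruxes/GroundStateSimpleEven/Disproof.lean`):

  rung  w → w'            ε_ev(w)    ε_od(w')   ratio
  1     1/100 → 3/200     2.4571     3.2283     1.31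
  2     3/200 → 1/40      2.0685     2.7175     1.31
  3     1/40  → 1/20      1.5915     2.0242     1.27
  4     1/20  → 1/10      0.98254    1.3307     1.35
  5     1/10  → 1/5       0.45709    0.63487    1.39
  6     1/5   → 3/10      0.094933   0.22257    2.34
  7     3/10  → (log 2)/2 0.0075725  0.073117   9.66   (odd side IN TREE: ε_od((log 2)/2) ≥ 1/20, `oddFloor_log_two_half`;
                                                          the stub keeps only the even ceiling ε_ev(3/10) ≤ 1/20, ratio 6.6)

(`ε_od(a) + log a` is constant to 3 digits on `a ≤ 1/10`: the odd bottom follows the pure dilation law, the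
even bottom drops faster — the parity ratio grows 1.48 → 55 along the ladder.)

## Contents

* `stub_logLadder` (rungs 1–3, LOG-KERNEL regime `a ≤ 1/20`), `stub_midLadder` (rungs 4–5, transition),
  `stub_topLadder` (rungs 6–7, polar-competition regime up to the endpoint) — the ONLY `sorry`s of the file.
* sorry-free infrastructure: `evenWinsAt_of_le` (order ⇒ the crux's junk-free matching form at one window,
  by `csInf` approximation on the nonempty even sphere), `le_of_bracket` (monotone bracketing),
  `integral_eq_zero_of_odd'`, `le_of_small` (the Suzuki range from the tree), `oddFloor_log_two_half` +
  `topRung_of_evenCeiling` (the in-tree odd-block certificate `θ = 1/20` at `(log 2)/2`, `WeilGapCert`, is the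
  odd half of rung 7 — load-bearing), `evenOrder_of_ladders` (the case analysis along the ladder: stub
  signatures ⇒ `ε_ev ≤ ε_od` on `(0, (log 2)/2]`).
* `EvenWinsArch_of : EvenWinsArch` — THE skeleton theorem: the crux BY NAME from the three declared stubs
  (the file's only theorem whose head is the crux decl, as `ledger skeleton check` requires).

Disproof.lean for this crux: none exists yet (`ledger crux ls`: no workfiles) — no `_false_without_` obligation
to honour; negatives index (2026-08-17): one entry (UniversalFactor.LaplaceLoophole), unrelated.
-/

set_option linter.dupNamespace false
set_option linter.unusedVariables false

noncomputable section

namespace Summit.RiemannHypothesis.RiemannHypothesis.Cruxes.EvenWinsArch.Birth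

open Set MeasureTheory
open Literature.NumberTheory.LFunctions
open Summit.RiemannHypothesis.RiemannHypothesis.Theses.WeilParity

/-! ## Transport stubs (lead's reshaping, v2): the rungs below are PROVED from these

Method (lead, `PICKED.md`): every rung certificate is obtained by DILATION TRANSPORT of the two in-tree
certificates at the top window `A = (log 2)/2` along the scale-covariance of the prime-free jump form
`𝓔(g) = ∫₀^∞ w(t) D_t(g) dt`, `w = weilArchDensity = e^{t/2}/(2 sinh t)`, `D_t = weilIncrement`.
With `Φ(t) = t·w(t)` (`= 1/2 + t/4 − t²/48 − …`) and the tail `T(x) = ∫_{Ioi x} w`: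
* even ceiling (`stub_bumpEnergy`, `stub_bumpData`, `Φ ≤ 1/2 + t/4`, `stub_formDomainPos` of the tree):
  `ε(r) ≤ U(r) = 31/30 + 7r/12 + (10/3) r (1 + r²/36)² + 2 T(2r) − M` for the rescaled bump `trialFun(x/3r)`;
* odd floor (`stub_phiLipschitz`, `stub_dilationEnergy`, `stub_incrementAverage`, the kernel-checked
  `weilGapCert`): `ε_od(a) ≥ L(a) = 1/20 + 2 (T(2a) − T(2A)) − 2 (sinh a − a) − (A − a)`;
* rung `w → w'`: `U(w) < L(w')`, an elementary inequality once `2(T(2w) − T(2w')) ≤ log(w'/w) + (w' − w)`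
  and `T(log 2) ≤ 1.49686` (`stub_archTailLogTwo`), `M ≥ 5.367` (tree). -/

/-- **Stub T1 — Φ is ¼-Lipschitz from above.** `Φ(t) = t · e^{t/2}/(2 sinh t)` satisfies
`Φ(y) − Φ(x) ≤ (y − x)/4` for `0 < x ≤ y` (all positive reals; `Φ'(t) = 1/4 − t/24 − 3t²/32 + … ≤ 1/4`).
Suggested proof: `Φ' = ½ e^{-t/2} [C' + 1 − (C + t)/2]` with `C = t coth t`; `e^{-t/2} ≤ 1/(1 + t/2)`; and
`F(s) = [cosh s − 1 − (s/2) sinh s] + [2(sinh s − s) − (3/4) s (cosh s − 1)] ≤ 0` (`s = 2t`, both brackets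
`≤ 0` by one/two monotonicity steps). [folklore] -/
theorem stub_phiLipschitz :
    ∀ x y : ℝ, 0 < x → x ≤ y →
      y * Literature.NumberTheory.LFunctions.weilArchDensity y -
          x * Literature.NumberTheory.LFunctions.weilArchDensity x ≤ (y - x) / 4 := by
  sorry

/-- **Stub T2 — dilation identity for the archimedean energy.** For a test function `g` supported in
`[-R, R]` and a compression factor `c > 0`: substituting `u = c t` and using `D_u(g) = 2‖g‖₂²` for `u > 2R`,
`∫₀^∞ w(t) D_{ct}(g) dt = ∫_{(0,2R]} (w(u/c)/c) D_u(g) du + 2‖g‖₂² T(2R/c)` (and the finite-part integrand is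
integrable). [folklore] -/
theorem stub_dilationEnergy :
    ∀ (g : ℝ → ℂ) (R c : ℝ), Literature.NumberTheory.LFunctions.IsWeilTest g →
      tsupport g ⊆ Set.Icc (-R) R → 0 < R → 0 < c →
      MeasureTheory.IntegrableOn
          (fun u : ℝ ↦ Literature.NumberTheory.LFunctions.weilArchDensity (u / c) / c *
            Literature.NumberTheory.LFunctions.weilIncrement g u) (Set.Ioc 0 (2 * R)) ∧
        ∫ t in Set.Ioi (0 : ℝ), Literature.NumberTheory.LFunctions.weilArchDensity t *
            Literature.NumberTheory.LFunctions.weilIncrement g (c * t) =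
          (∫ u in Set.Ioc (0 : ℝ) (2 * R), Literature.NumberTheory.LFunctions.weilArchDensity (u / c) / c *
              Literature.NumberTheory.LFunctions.weilIncrement g u) +
            2 * (∫ x : ℝ, ‖g x‖ ^ 2) *
              ∫ t in Set.Ioi (2 * R / c), Literature.NumberTheory.LFunctions.weilArchDensity t := by
  sorry

/-- **Stub T3 — the increment average.** For a test function `g` supported in `[-R, R]`,
`∫_{(0,2R]} D_u(g) du = 4R‖g‖₂² − |∫ g|² ≤ 4R ‖g‖₂²` (`D_u = 2‖g‖² − (k(u) + k(−u))`, `k = g ⋆ g̃`,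
`∫_{−2R}^{2R} k = |∫ g|² ≥ 0` by Fubini); `u ↦ D_u(g)` is integrable on `(0, 2R]`. [folklore] -/
theorem stub_incrementAverage :
    ∀ (g : ℝ → ℂ) (R : ℝ), Literature.NumberTheory.LFunctions.IsWeilTest g →
      tsupport g ⊆ Set.Icc (-R) R → 0 < R →
      MeasureTheory.IntegrableOn (Literature.NumberTheory.LFunctions.weilIncrement g) (Set.Ioc 0 (2 * R)) ∧
        ∫ u in Set.Ioc (0 : ℝ) (2 * R), Literature.NumberTheory.LFunctions.weilIncrement g u ≤
          4 * R * ∫ x : ℝ, ‖g x‖ ^ 2 := by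
  sorry

/-- **Stub T4 — energy of the rescaled bump.** For `0 < r ≤ 1/3` the bump `f(x) = trialFun (x/(3r))`
(`= (1 − x²/r²)⁺`, supported in `[-r, r]`) has finite archimedean energy and
`𝓔_r(f) ≤ (248/225) r + (28/45) r² + (32/15) r T(2r)`: no prime enters (`2r < log 2`);
`D_t(f) = 3r D_{t/3r}(trialFun)`; substitute `t = 3rs`: `𝓔 = 9r² ∫₀^∞ w(3rs) D_s(trialFun) ds`; on `s > 2/3`,
`D_s = 32/45` (tree `weilIncrement_trialFun_of_ge`) giving `(32/15) r T(2r)`; on `(0, 2/3]`,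
`9r² w(3rs) = 3r Φ(3rs)/s ≤ 3r/(2s) + 9r²/4` (`Φ ≤ 1/2 + t/4`, from the tree's Padé bound
`two_mul_mul_weilArchDensity_le`) against `D_s = 8s² − 12s³ + (27/5)s⁵` (tree `weilIncrement_trialFun_of_le`),
and `∫₀^{2/3} (8s − 12s² + (27/5)s⁴) = 4464/6075`, `∫₀^{2/3} (8s² − 12s³ + (27/5)s⁵) = 112/405`. [folklore] -/
theorem stub_bumpEnergy :
    ∀ r : ℝ, 0 < r → r ≤ 1 / 3 →
      MeasureTheory.IntegrableOn
          (fun t : ℝ ↦ Literature.NumberTheory.LFunctions.weilArchDensity t *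
            Literature.NumberTheory.LFunctions.weilIncrement
              (fun x : ℝ ↦ Summit.RiemannHypothesis.RiemannHypothesis.Theorems.WeilGroundState.trialFun
                (x / (3 * r))) t) (Set.Ioi 0) ∧
        Literature.NumberTheory.LFunctions.weilDirichletEnergy r
            (fun x : ℝ ↦ Summit.RiemannHypothesis.RiemannHypothesis.Theorems.WeilGroundState.trialFun
              (x / (3 * r))) ≤
          248 / 225 * r + 28 / 45 * r ^ 2 +
            32 / 15 * r * ∫ t in Set.Ioi (2 * r), Literature.NumberTheory.LFunctions.weilArchDensity t := by
  sorry

/-- **Stub T5 — data of the rescaled bump.** For `0 < r ≤ 1/3`, `f(x) = trialFun (x/(3r))` is in `L²`,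
vanishes off `[-r, r]`, has `‖f‖₂² = (16/15) r`, and pole form
`P(f) = 2 |∫ f cosh(x/2)|² ≤ (32/9) r² (1 + r²/36)²` (`f` real and even, so the `sinh` part vanishes;
`∫ f cosh(x/2) = 3r ∫ trialFun(y) cosh(3ry/2) dy ≤ 3r (4/9 + (81/71)·(108/10935) r²)` by the tree's
`cosh_half_le`). [folklore] -/
theorem stub_bumpData :
    ∀ r : ℝ, 0 < r → r ≤ 1 / 3 →
      MeasureTheory.MemLp
          (fun x : ℝ ↦ Summit.RiemannHypothesis.RiemannHypothesis.Theorems.WeilGroundState.trialFun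
            (x / (3 * r))) 2 MeasureTheory.volume ∧
        (∀ x : ℝ, x ∉ Set.Icc (-r) r →
          Summit.RiemannHypothesis.RiemannHypothesis.Theorems.WeilGroundState.trialFun (x / (3 * r)) = 0) ∧
        ∫ x : ℝ, ‖Summit.RiemannHypothesis.RiemannHypothesis.Theorems.WeilGroundState.trialFun
            (x / (3 * r))‖ ^ 2 = 16 / 15 * r ∧
        Literature.NumberTheory.LFunctions.weilPoleForm
            (fun x : ℝ ↦ Summit.RiemannHypothesis.RiemannHypothesis.Theorems.WeilGroundState.trialFun
              (x / (3 * r))) ≤ 32 / 9 * r ^ 2 * (1 + r ^ 2 / 36) ^ 2 := by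
  sorry

/-- **Stub T6 — the tail constant at the top window.** `T(log 2) = ∫_{log 2}^∞ e^{t/2}/(2 sinh t) dt
= √2 Σ_k 4^{-k}/(4k+1) = 1.496853…  ≤ 1.49686` (geometric expansion `w = Σ_k e^{-(2k+1/2)t}`, six terms and
the tail `e^{-(2K+1/2)t}/(1 − e^{-2t}) ≤ (4/3) e^{-(2K+1/2)t}` on `t ≥ log 2`; template: the tree's
`setIntegral_Ioi_weilArchDensity_le`). [folklore] -/
theorem stub_archTailLogTwo :
    ∫ t in Set.Ioi (Real.log 2), Literature.NumberTheory.LFunctions.weilArchDensity t ≤ 1.49686 := by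
  sorry

/-- **Stub T7 — the odd-sector floor by dilation transport** (lead; composed from T1–T3 and the
kernel-checked `weilGapCert`): for `0 < a ≤ (log 2)/2`,
`1/20 + 2 (T(2a) − T(log 2)) − 2 (sinh a − a) − ((log 2)/2 − a) ≤ ε_od(a)`. [folklore] -/
theorem stub_oddFloor :
    ∀ a : ℝ, 0 < a → a ≤ Real.log 2 / 2 →
      1 / 20 + 2 * ((∫ t in Set.Ioi (2 * a), Literature.NumberTheory.LFunctions.weilArchDensity t) -
            ∫ t in Set.Ioi (Real.log 2), Literature.NumberTheory.LFunctions.weilArchDensity t) -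
          2 * (Real.sinh a - a) - (Real.log 2 / 2 - a) ≤
        Literature.NumberTheory.LFunctions.weilOddGroundEnergy a := by
  sorry

/-- **Stub T8 — the even-sector ceiling** (lead; composed from T4–T5 and the tree's form-domain Rayleigh
principle `stub_formDomainPos`): for `0 < r ≤ 1/3`,
`ε(r) ≤ 31/30 + 7r/12 + (10/3) r (1 + r²/36)² + 2 T(2r) − M_{(log 2)/2}`. [folklore] -/
theorem stub_evenCeiling :
    ∀ r : ℝ, 0 < r → r ≤ 1 / 3 →
      Literature.NumberTheory.LFunctions.weilGroundEnergy r ≤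
        31 / 30 + 7 / 12 * r + 10 / 3 * r * (1 + r ^ 2 / 36) ^ 2 +
            2 * (∫ t in Set.Ioi (2 * r), Literature.NumberTheory.LFunctions.weilArchDensity t) -
          Literature.NumberTheory.LFunctions.weilMarkovConstant (Real.log 2 / 2) := by
  sorry

/-! ## The three registered stubs (rung certificates of the parity ladder) -/

/-- **Stub 1 — LOG-KERNEL LADDER (rungs 1–3, windows `1/100 ↔ 1/20`).** Three two-window parity
certificates `ε_ev(w) ≤ ε_od(w')`. Predicted values (ratio ≥ 1.27): `2.4571 ≤ 3.2283`, `2.0685 ≤ 2.7175`,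
`1.5915 ≤ 2.0242`. Why plausibly true: both bottoms are `O(1)` bulk quantities here, `ε_od(a) ≈ log(1/a) − 0.97`,
and in Suzuki's scale-free jump form the parity gap `ν⁻ − ν⁺ ≈ 1.2` exceeds `log` of every rung ratio
(`log 2 ≈ 0.69`). Methods: (a) certified Rayleigh–Ritz ceilings (explicit even bumps, Markov decomposition
`weilQuadratic_re_eq_weilPoleForm_add_weilDirichletEnergy_sub`) + odd-block floor certificates (re-run the
tree's `WeilGapCert.checkG` machinery at `a₀ = 3/200, 1/40, 1/20`); or (b) analytically, push the tree's
plateau/bathtub argument (`weilGroundEnergy_add_le_of_integral_eq_zero`, proved for `a ≤ 1/100`) across two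
windows. Size: M–L (three certificates at moderate precision). Sources: Suzuki2026 (arXiv:2606.09096 §4.5, §5),
Bombieri2000Weil (Thm 5), the tree files named. -/
theorem stub_logLadder :
    Literature.NumberTheory.LFunctions.weilEvenGroundEnergy (1 / 100) ≤
        Literature.NumberTheory.LFunctions.weilOddGroundEnergy (3 / 200) ∧
      Literature.NumberTheory.LFunctions.weilEvenGroundEnergy (3 / 200) ≤
        Literature.NumberTheory.LFunctions.weilOddGroundEnergy (1 / 40) ∧
      Literature.NumberTheory.LFunctions.weilEvenGroundEnergy (1 / 40) ≤
        Literature.NumberTheory.LFunctions.weilOddGroundEnergy (1 / 20) := by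
  sorry

/-- **Stub 2 — TRANSITION LADDER (rungs 4–5, windows `1/20 ↔ 1/5`).** `ε_ev(1/20) ≤ ε_od(1/10)` and
`ε_ev(1/10) ≤ ε_od(1/5)`; predicted `0.98254 ≤ 1.3307` (ratio 1.35) and `0.45709 ≤ 0.63487` (ratio 1.39).
Here the pole form `P(g) = 2|∫g cosh(t/2)|² − 2|∫g sinh(t/2)|²` starts to compete with the log-kernel
parity gap (the even bottom leaves the `log(1/a)` law), so the certificates must carry the polar vectors.
Method: certified two-sided Rayleigh–Ritz / odd-block certificates as for stub 1 (bottoms still ≥ 0.45, no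
precision wall). Size: M–L. Sources: Bombieri2000Weil (Thm 5, §13), ConnesConsani2023 (§2.1.3),
Cruxes/GroundStateSimpleEven/Disproof.lean (table). -/
theorem stub_midLadder :
    Literature.NumberTheory.LFunctions.weilEvenGroundEnergy (1 / 20) ≤
        Literature.NumberTheory.LFunctions.weilOddGroundEnergy (1 / 10) ∧
      Literature.NumberTheory.LFunctions.weilEvenGroundEnergy (1 / 10) ≤
        Literature.NumberTheory.LFunctions.weilOddGroundEnergy (1 / 5) := by
  sorry

/-- **Stub 3 — TOP LADDER (rungs 6–7, windows `1/5 ↔ (log 2)/2`, the polar-competition regime the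
crux's "why it might fail" points at).** Rung 6: `ε_ev(1/5) ≤ ε_od(3/10)` (predicted `0.094933 ≤ 0.22257`,
ratio 2.3; needs an odd-block certificate at `a₀ = 3/10`, any `θ ∈ (0.1, 0.22)`, and an even ceiling at `1/5`
below it). Rung 7 = `ε_ev(3/10) ≤ ε_od((log 2)/2)` (predicted `0.0075725 ≤ 0.073117`) is stated here by its
EVEN HALF ONLY, `ε_ev(3/10) ≤ 1/20`, because its odd half is IN THE TREE: `ε_od((log 2)/2) ≥ 1/20`
(`oddFloor_log_two_half` below, the kernel-checked certificate `WeilGapCert`, θ = 1/20; composition via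
`topRung_of_evenCeiling`). So rung 7 is ONE explicit even bump on `[-3/10, 3/10]` with certified
`Re Q ≤ (1/20)‖·‖₂²`, a factor 6.6 above the bottom (the tree's `…Trial4.lean` does exactly this kind of
estimate at `(log 2)/2` with the bump `(1 − 9x²)⁺`, getting `3/200`). Size: M (rung 7) + M–L (rung 6).
Sources: Theorems/WeilGroundStateArchimedeanWindowSimpleEven.lean (θ = 1/20, ε ≤ 3/200), Bombieri2000Weil
(Thm 5), arXiv:2006.13771. -/
theorem stub_topLadder :
    Literature.NumberTheory.LFunctions.weilEvenGroundEnergy (1 / 5) ≤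
        Literature.NumberTheory.LFunctions.weilOddGroundEnergy (3 / 10) ∧
      Literature.NumberTheory.LFunctions.weilEvenGroundEnergy (3 / 10) ≤ 1 / 20 := by
  sorry

/-! ## Sorry-free infrastructure -/

/-- **ORDER ⇒ MATCHING** (the crux's junk-free form at one window `a > 0` from the order of the sector
bottoms): if `ε_ev(a) ≤ ε_od(a)` then every odd normalised test `o` on `[-a, a]` is matched up to any
`δ > 0` by an even normalised test `e` with `Re Q(e) ≤ Re Q(o) + δ`. Proof: `ε_od(a) ≤ Re Q(o)`
(`weilOddGroundEnergy_le`), and `ε_ev(a)` is the infimum of a nonempty set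
(`weilWindowSphereValues_even_nonempty`), so some even sphere element is `< ε_ev(a) + δ`. [folklore] -/
theorem evenWinsAt_of_le {a : ℝ} (ha : 0 < a)
    (hle : weilEvenGroundEnergy a ≤ weilOddGroundEnergy a) :
    ∀ o : ℝ → ℂ, IsWeilTest o → tsupport o ⊆ Set.Icc (-a) a → (∀ t, o (-t) = -o t) →
      ∫ t, ‖o t‖ ^ 2 = (1 : ℝ) → ∀ δ : ℝ, 0 < δ → ∃ e : ℝ → ℂ, IsWeilTest e ∧
        tsupport e ⊆ Set.Icc (-a) a ∧ (∀ t, e (-t) = e t) ∧ ∫ t, ‖e t‖ ^ 2 = (1 : ℝ) ∧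
        (weilQuadratic e).re ≤ (weilQuadratic o).re + δ := by
  intro o ho hos hodd hon δ hδ
  have hodd_le : weilOddGroundEnergy a ≤ (weilQuadratic o).re :=
    weilOddGroundEnergy_le ho hos hodd hon
  have hne := weilWindowSphereValues_even_nonempty ha
  have hlt : sInf (weilWindowSphereValues (fun g ↦ ∀ t, g (-t) = g t) a) <
      weilEvenGroundEnergy a + δ := by
    rw [← weilEvenGroundEnergy_eq_sInf]
    linarith
  obtain ⟨x, hx, hxlt⟩ := exists_lt_of_csInf_lt hne hlt
  obtain ⟨e, he, hes, hev, hen, rfl⟩ := hx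
  exact ⟨e, he, hes, hev, hen, by linarith⟩

/-- **MONOTONE BRACKETING** (the engine of the ladder): an even ceiling at the smaller window `α` below
the odd floor at the larger window `β` settles the order at every window in between,
`ε_ev(a) ≤ ε_ev(α) ≤ ε_od(β) ≤ ε_od(a)` for `0 < α ≤ a ≤ β` (both bottoms are antitone in the window,
Bombieri 2000 Thm 5). [cite: Bombieri2000Weil, §4 Thm. 5 (p. 197)] -/
theorem le_of_bracket {α β a : ℝ} (hα : 0 < α) (hαa : α ≤ a) (haβ : a ≤ β)
    (h : weilEvenGroundEnergy α ≤ weilOddGroundEnergy β) :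
    weilEvenGroundEnergy a ≤ weilOddGroundEnergy a :=
  calc weilEvenGroundEnergy a ≤ weilEvenGroundEnergy α := weilEvenGroundEnergy_antitone hα hαa
    _ ≤ weilOddGroundEnergy β := h
    _ ≤ weilOddGroundEnergy a := weilOddGroundEnergy_antitone (lt_of_lt_of_le hα hαa) haβ

/-- Odd functions have integral zero (`∫ g(−x) = ∫ g` and `g(−x) = −g(x)`). [folklore] -/
theorem integral_eq_zero_of_odd' {g : ℝ → ℂ} (hodd : ∀ t, g (-t) = -g t) : ∫ x : ℝ, g x = 0 := by
  have h1 : ∫ x : ℝ, g (-x) = ∫ x : ℝ, g x := integral_neg_eq_self g volume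
  have h2 : ∫ x : ℝ, g (-x) = -∫ x : ℝ, g x := by
    simp_rw [hodd]
    exact integral_neg g
  have h3 : (2 : ℂ) * ∫ x : ℝ, g x = 0 := by
    have := h1.symm.trans h2
    linear_combination this
  exact (mul_eq_zero.1 h3).resolve_left two_ne_zero

/-- **THE SUZUKI RANGE, from the tree**: for `0 < a ≤ 1/100`, `ε_ev(a) ≤ ε_od(a)` (indeed with the gap
`1/10`: `ε(a) + 1/10 ≤ Re Q(o)` for odd normalised `o` by `weilGroundEnergy_add_le_of_integral_eq_zero`
— odd functions are mean-zero — so `ε(a) + 1/10 ≤ ε_od(a)`, and `ε(a) = min (ε_ev(a), ε_od(a))`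
(`weilGroundEnergy_eq_min_even_odd`) forces the minimum to be the even one).
[cite: Suzuki2026, Thm. 1.4 (p. 4), tree `Suzuki2026_thm_1_4_holds`] -/
theorem le_of_small {a : ℝ} (ha : 0 < a) (ha' : a ≤ 1 / 100) :
    weilEvenGroundEnergy a ≤ weilOddGroundEnergy a := by
  have hgap : weilGroundEnergy a + 1 / 10 ≤ weilOddGroundEnergy a := by
    refine le_weilOddGroundEnergy_of_forall ha fun g hg hs hodd hn ↦ ?_
    exact weilGroundEnergy_add_le_of_integral_eq_zero hg ha ha' hs hn (integral_eq_zero_of_odd' hodd)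
  have hmin := weilGroundEnergy_eq_min_even_odd a
  by_contra hlt
  push Not at hlt
  rw [min_eq_right hlt.le] at hmin
  linarith

/-- **The odd side of the top rung is in the tree**: `1/20 ≤ ε_od((log 2)/2)`, from the kernel-checked
gap certificate of route WeilGroundState's item `ArchimedeanWindowSimpleEven`
(`WeilGapCert.weilQuadratic_re_ge_of_checkG weilGapCert_checkG`, `θ = 1/20`: `(1/20)‖g‖₂² ≤ Re Q(g)` for
every odd test on that window). Hence rung 7 reduces to the even ceiling `ε_ev(3/10) ≤ 1/20`. [folklore] -/
theorem oddFloor_log_two_half : (1 / 20 : ℝ) ≤ weilOddGroundEnergy (Real.log 2 / 2) := by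
  have ha : 0 < Real.log 2 / 2 := by have := Real.log_pos one_lt_two; positivity
  refine le_weilOddGroundEnergy_of_forall ha fun g hg hs hodd hn ↦ ?_
  have hθ := Summit.RiemannHypothesis.RiemannHypothesis.Theorems.WeilGroundState.WeilGapCert.weilQuadratic_re_ge_of_checkG
    Summit.RiemannHypothesis.RiemannHypothesis.Theorems.WeilGroundState.weilGapCert_checkG hg hs (Or.inl hodd)
  rw [hn, mul_one,
    show Summit.RiemannHypothesis.RiemannHypothesis.Theorems.WeilGroundState.weilGapCert.theta = 1 / 20
      from rfl] at hθ
  push_cast at hθ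
  linarith

/-- Rung 7 from its even half alone (the odd half being `oddFloor_log_two_half`). [folklore] -/
theorem topRung_of_evenCeiling (h : weilEvenGroundEnergy (3 / 10) ≤ 1 / 20) :
    weilEvenGroundEnergy (3 / 10) ≤ weilOddGroundEnergy (Real.log 2 / 2) :=
  h.trans oddFloor_log_two_half

/-- `3/10 < (log 2)/2` (so the ladder is increasing; not needed by the logic, recorded for the reader):
`log 2 > 0.6931471803`. -/
example : (3 / 10 : ℝ) < Real.log 2 / 2 := by
  have := Real.log_two_gt_d9
  linarith

/-- **THE LADDER ARGUMENT** (sorry-free): the seven rung certificates (the three stub signatures, taken as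
hypotheses) and the tree's Suzuki range give the order of the sector bottoms on every prime-free window,
`ε_ev(a) ≤ ε_od(a)` for `0 < a ≤ (log 2)/2` — locate the cell of `a` and bracket. [folklore] -/
theorem evenOrder_of_ladders
    (h₁ : weilEvenGroundEnergy (1 / 100) ≤ weilOddGroundEnergy (3 / 200) ∧
      weilEvenGroundEnergy (3 / 200) ≤ weilOddGroundEnergy (1 / 40) ∧
      weilEvenGroundEnergy (1 / 40) ≤ weilOddGroundEnergy (1 / 20))
    (h₂ : weilEvenGroundEnergy (1 / 20) ≤ weilOddGroundEnergy (1 / 10) ∧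
      weilEvenGroundEnergy (1 / 10) ≤ weilOddGroundEnergy (1 / 5))
    (h₃ : weilEvenGroundEnergy (1 / 5) ≤ weilOddGroundEnergy (3 / 10) ∧
      weilEvenGroundEnergy (3 / 10) ≤ 1 / 20)
    {a : ℝ} (ha : 0 < a) (hle : a ≤ Real.log 2 / 2) :
    weilEvenGroundEnergy a ≤ weilOddGroundEnergy a := by
  obtain ⟨r1, r2, r3⟩ := h₁
  obtain ⟨r4, r5⟩ := h₂
  obtain ⟨r6, r7⟩ := h₃
  rcases le_or_gt a (1 / 100) with h0 | h0
  · exact le_of_small ha h0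
  rcases le_or_gt a (3 / 200) with h1 | h1
  · exact le_of_bracket (by norm_num) h0.le h1 r1
  rcases le_or_gt a (1 / 40) with h2 | h2
  · exact le_of_bracket (by norm_num) h1.le h2 r2
  rcases le_or_gt a (1 / 20) with h3 | h3
  · exact le_of_bracket (by norm_num) h2.le h3 r3
  rcases le_or_gt a (1 / 10) with h4 | h4
  · exact le_of_bracket (by norm_num) h3.le h4 r4
  rcases le_or_gt a (1 / 5) with h5 | h5
  · exact le_of_bracket (by norm_num) h4.le h5 r5
  rcases le_or_gt a (3 / 10) with h6 | h6
  · exact le_of_bracket (by norm_num) h5.le h6 r6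
  · exact le_of_bracket (by norm_num) h6.le hle (topRung_of_evenCeiling r7)

/-! ## The skeleton theorem: the crux BY NAME from the three declared stubs -/

/-- **THE SKELETON THEOREM.** The crux
`Summit.RiemannHypothesis.RiemannHypothesis.Theses.WeilParity.EvenWinsArch`, concluded BY NAME from the
three DECLARED stubs `stub_logLadder`, `stub_midLadder`, `stub_topLadder` (the only `sorry`s of the file)
through the sorry-free ladder argument `evenOrder_of_ladders` and the order-to-matching glue
`evenWinsAt_of_le`. [folklore] -/
theorem EvenWinsArch_of : EvenWinsArch := by
  intro a ha hle o ho hos hodd hon δ hδ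
  exact evenWinsAt_of_le ha
    (evenOrder_of_ladders stub_logLadder stub_midLadder stub_topLadder ha hle) o ho hos hodd hon δ hδ

end Summit.RiemannHypothesis.RiemannHypothesis.Cruxes.EvenWinsArch.Birth

end
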